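import Summits.BirchSwinnertonDyer.BirchSwinnertonDyer.Theorems.ErratumRoadFiveNonSurjCornerKolyJSwapKappa
import HarnessLib

/-!
# Route `ErratumRoadFive` (rung K2), crux child `NonSurjCornerKolyJ` (item stmt-BirchSwinnertonDyer-19947), registered stub
# `stub_kolyJ_max` — DISPLAY v3: the stub ⟸ {Gross Prop. 3.7 (2) BY NAME; `−1 ∈ ρ̄_{E,7}(Γ_ℚ)` at `p = 7`; the level-`p`
# PAIRING supply per family; hlev}; and the (T4″)@3 twin for 19111's Upper kit
# (cell `bsd-stepL`, seat `bsd-stepL-corner-p1` g11; `--supports stmt-BirchSwinnertonDyer-19947`; memo CORNER-G10 §3 (3))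

WHAT. `nonSurjCornerKolyJ_max_of_frobeniusCongruence_of_pairingSupply_of_perLevel`: the registered signature of
`stub_kolyJ_max` VERBATIM from (a) the Literature fact `GrossLMS1991.prop37_2_frobeniusCongruence` (Gross 1991 Prop. 3.7 (2)
= Nekovář 2007 Prop. 4.13 (ii); image-free; Eichler–Shimura), (b) per corner frame: `−1 ∈ ρ̄_{E,7}(Γ_ℚ)` when `p = 7`
(genuine restriction: Cartan-normaliser images without `−I`), and for every family `D` over the Zhang–Kolyvagin
conductors of index `≥ M+1` with all `P(D s)` `p^M`-divisible: `τ ≠ 1`, a level-`p` Selmer structure `𝒯`, signs `eb` with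
`heb`, the duality count `hPT` at a relaxed Kolyvagin place, the local Tate pairing package `pair ∕ hperf ∕ hrec`, and the
SIGNED `𝒯`-SELMER MEMBERSHIP of the level-`p` class pushing forward to `c_{M+1}(D s)` — all but the last shared in kind
with 19109's walk ∕ duality supplies —, (c) `hlev` (tam3's walk conclusion per frame, shared with 19109). Compared with the
reading of record (p522786) the κ̄-dictionary (`κb`, `hκSel` as stated there, `h44c`, `hκ0`) is GONE: constructed and
proved in `…SwapKappa.lean` (McCallum Prop. 4.4 on the irreducible corner = this seat's kernel theorem modulo (γ), (γ) by
name). `cornerUpper3_jetchevMax_of_frobeniusCongruence_of_pairingSupply_of_perLevel`: the same for 19111's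
`stub_upper3_jetchevMax` at `p = 3`, where the prime step `ℓ = 2` (possible at `M = 0`; un-printed) is carried as an
explicit clause. HONEST FRAMING: two CONDITIONAL displays; no definition ∕ fact ∕ sorry; no stub closes; nothing about
any curve; BSD is not advanced; T7.
References: [McCallumLMS1991] §4 Prop. 4.4, §5 Prop. 5.2; [GrossLMS1991] Prop. 3.7 (2), Prop. 5.4; [Nekovar2007] Prop.
4.13 (ii); [BurungaleEtAl2026] Prop. 2.2.1; [Jetchev2008] Thm. 1.4, Prop. 4.9, §4.2.
-/

set_option autoImplicit false

noncomputable section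

open scoped Classical NumberField

namespace Summit.BirchSwinnertonDyer.Rank1Residual.X11b.Three.Koly

open WeierstrassCurve IsDedekindDomain NumberField Field Literature.NumberTheory.EllipticCurves
  Literature.NumberTheory.EllipticCurves.ModularForms Literature.NumberTheory.EllipticCurves.Jetchev2008
  Literature.NumberTheory.EllipticCurves.Rank1Residual Literature.NumberTheory.EllipticCurves.KolyvaginCocycle
  Literature.NumberTheory.GaloisRepresentations Literature.NumberTheory.GaloisCohomology
  Literature.NumberTheory.GaloisRepresentations.DiscreteGaloisModule
  Summit.BirchSwinnertonDyer.Rank1Residual Summit.BirchSwinnertonDyer.Rank1Residual.X11b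
  Summit.BirchSwinnertonDyer.Rank1Residual.JET
  Summit.BirchSwinnertonDyer.BirchSwinnertonDyer.Theorems

variable {K : Type} [Field K] [NumberField K] (W : WeierstrassCurve ℚ) [W.IsElliptic] [W.IsGloballyMinimal]
  [NeZero (W.conductorNorm ℤ)]


/-- **DISPLAY v3 — `stub_kolyJ_max` ⟸ {Gross Prop. 3.7 (2) BY NAME; (ii) `−1 ∈ ρ̄_{E,7}(Γ_ℚ)` at `p = 7`; (iv′) the
level-`p` PAIRING supply per family; hlev}.** The reading of record `nonSurjCornerKolyJ_max_of_levelOneSupply_of_perLevel`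
(p522786) with the κ̄-DICTIONARY of its per-family swap supply (iv) DISCHARGED: the level-`p` classes `κ̄_s` are no
longer supplied but CONSTRUCTED (McCallum's avatars of `P_s ∕ p^M`, `exists_levelOne_kappa_of_h44`), their `hκ0` clause is
a theorem, and their Prop-4.4 clause `h44c` is McCallum Prop. 4.4 «in particular» on the irreducible corner — a KERNEL
theorem of this seat (g9–g10) modulo Gross Prop. 3.7 (2), here taken BY NAME as the Literature fact
`GrossLMS1991.prop37_2_frobeniusCongruence` (`h37`). What (iv′) still asks per family `D` (all `P(D s)` `p^M`-divisible):
`τ ≠ 1`, a level-`p` Selmer structure `𝒯`, Gross signs `eb`, the duality count `hPT`, the local Tate pairing package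
(`pair`, `hperf`, `hrec`) — VERBATIM as in (iv) — and, in place of `hκSel ∕ h44c ∕ hκ0`, ONE clause: every level-`p`
class pushing forward to `c_{M+1}(D s)` lies in the `eb s`-signed `𝒯`-Selmer group at `s` (signed Selmer membership
of the genuine Kolyvagin class read at level `p`; Gross 5.4 sign + McCallum Lemma 4.3 ∕ Jetchev Prop. 4.9 ∕ §4.2 local
conditions — shared with 19109's walk supply). CONDITIONAL on `h37` and on the supplies; nothing booked; no stub closes.
[cite: McCallumLMS1991, §4 Prop. 4.4, §5 Prop. 5.2 (p. 304)] [cite: GrossLMS1991, Prop. 3.7 (2), Prop. 5.4]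
[cite: BurungaleEtAl2026, Prop. 2.2.1 (§2.2)] [cite: Jetchev2008, Thm. 1.4 (p. 812), Prop. 4.9] -/
theorem nonSurjCornerKolyJ_max_of_frobeniusCongruence_of_pairingSupply_of_perLevel
    (h37 : GrossLMS1991.prop37_2_frobeniusCongruence)
    (hsupply : ∀ (W : WeierstrassCurve ℚ) [W.IsElliptic] [W.IsGloballyMinimal] [NeZero (W.conductorNorm ℤ)]
      (p : ℕ) [Fact p.Prime] (K : Type) [Field K] [NumberField K]
      (Dt : ModularParametrizationData W (W.conductorNorm ℤ)) (β : ℤ) (ι : K →+* ℂ),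
      p ∣ W.tamagawaProduct →
      ClassX11b W p → ¬ Surj W p → (p = 5 ∨ p = 7) → p ∣ padicValInt p W.minimalDiscriminantInt →
      ¬ Ram W p → IsImaginaryQuadratic K → 4 < (NumberField.discr K).natAbs →
      SatisfiesHeegnerHypothesis (W.conductorNorm ℤ) K → SatisfiesHeegnerHypothesis p K →
      (4 * (W.conductorNorm ℤ : ℤ)) ∣ β ^ 2 - NumberField.discr K → ¬ (p : ℤ) ∣ Dt.c →
      (p = 7 → ∃ γ : Field.absoluteGaloisGroup ℚ, ∀ P : geomTorsion W p, γ • P = -P) ∧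
      (∀ (M e : ℕ) (D : ∀ s : {m : ℕ // Squarefree m ∧ ∀ q ∈ m.primeFactors,
            Zhang2014.IsKolyvaginPrime (W.conductorNorm ℤ) W K p q ∧ M + 1 ≤ Zhang2014.kolyvaginIndex W p q},
          KolyvaginHeegnerData Dt β ι s.1), (∀ s, PDiv (D s) p M) →
        ∃ (τ : K ≃ₐ[ℚ] K) (_ : τ ≠ 1)
          (𝒯 : SelmerStructure ((W.baseChange K).torsionGaloisModule ((p ^ 1 : ℕ) : ℤ))) (eb : ℕ → Bool)
          (Z : Type) (_ : AddCommGroup Z)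
          (pair : ∀ v : HeightOneSpectrum (𝓞 K),
          galoisCohomology (((W.baseChange K).torsionGaloisModule ((p ^ 1 : ℕ) : ℤ)).toLocal (Sum.inr v)) 1 →+
          galoisCohomology (((W.baseChange K).torsionGaloisModule ((p ^ 1 : ℕ) : ℤ)).toLocal (Sum.inr v)) 1 →+ Z),
          (∀ (m ℓ : ℕ), ℓ.Prime → ¬ ℓ ∣ m → eb (m * ℓ) = !eb m) ∧
          (∀ (s : {m : ℕ // Squarefree m ∧ ∀ q ∈ m.primeFactors,
            Zhang2014.IsKolyvaginPrime (W.conductorNorm ℤ) W K p q ∧ M + 1 ≤ Zhang2014.kolyvaginIndex W p q})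
          (ℓ : ℕ), Zhang2014.IsKolyvaginPrime (W.conductorNorm ℤ) W K p ℓ →
          M + 1 ≤ Zhang2014.kolyvaginIndex W p ℓ → ¬ ℓ ∣ s.1 →
          ∀ v : HeightOneSpectrum (𝓞 K), (ℓ : 𝓞 K) ∈ v.asIdeal → ∀ b : Bool,
          Nat.card ((signPart W K τ ((p ^ 1 : ℕ) : ℤ) (if b then 1 else -1)
              ((selmerF W ((p ^ 1 : ℕ) : ℤ) 𝒯 (placesDividing K s.1)).relaxedAt {v}).selmerGroup).map
            (galoisCohomology.localization ((W.baseChange K).torsionGaloisModule ((p ^ 1 : ℕ) : ℤ))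
              (Sum.inr v) 1)) = p ^ 1) ∧
          (∀ (ℓ : ℕ), Zhang2014.IsKolyvaginPrime (W.conductorNorm ℤ) W K p ℓ →
          M + 1 ≤ Zhang2014.kolyvaginIndex W p ℓ → ∀ v : HeightOneSpectrum (𝓞 K), (ℓ : 𝓞 K) ∈ v.asIdeal →
          ∀ (e : ℤ), (e = 1 ∨ e = -1) →
          ∀ (x y : galoisCohomology ((W.baseChange K).torsionGaloisModule ((p ^ 1 : ℕ) : ℤ)) 1),
          conjAct W τ ((p ^ 1 : ℕ) : ℤ) x = e • x → conjAct W τ ((p ^ 1 : ℕ) : ℤ) y = e • y →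
          galoisCohomology.localization ((W.baseChange K).torsionGaloisModule ((p ^ 1 : ℕ) : ℤ)) (Sum.inr v) 1 x ∈
            𝒯 (Sum.inr v) →
          galoisCohomology.localization ((W.baseChange K).torsionGaloisModule ((p ^ 1 : ℕ) : ℤ)) (Sum.inr v) 1 y ∈
            (W.baseChange K).kummerSelmerStructure ((p ^ 1 : ℕ) : ℤ) (Sum.inr v) →
          galoisCohomology.localization ((W.baseChange K).torsionGaloisModule ((p ^ 1 : ℕ) : ℤ)) (Sum.inr v) 1 x ≠ 0 →
          galoisCohomology.localization ((W.baseChange K).torsionGaloisModule ((p ^ 1 : ℕ) : ℤ)) (Sum.inr v) 1 y ≠ 0 →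
          pair v (galoisCohomology.localization ((W.baseChange K).torsionGaloisModule ((p ^ 1 : ℕ) : ℤ)) (Sum.inr v) 1 x)
            (galoisCohomology.localization ((W.baseChange K).torsionGaloisModule ((p ^ 1 : ℕ) : ℤ)) (Sum.inr v) 1 y) ≠ 0) ∧
          (∀ (s : {m : ℕ // Squarefree m ∧ ∀ q ∈ m.primeFactors,
            Zhang2014.IsKolyvaginPrime (W.conductorNorm ℤ) W K p q ∧ M + 1 ≤ Zhang2014.kolyvaginIndex W p q})
          (ℓ₀ ℓ : ℕ), Zhang2014.IsKolyvaginPrime (W.conductorNorm ℤ) W K p ℓ₀ → M + 1 ≤ Zhang2014.kolyvaginIndex W p ℓ₀ →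
          Zhang2014.IsKolyvaginPrime (W.conductorNorm ℤ) W K p ℓ → M + 1 ≤ Zhang2014.kolyvaginIndex W p ℓ →
          ¬ ℓ₀ ∣ s.1 → ¬ ℓ ∣ s.1 → ℓ ≠ ℓ₀ →
          ∀ v₀ : HeightOneSpectrum (𝓞 K), (ℓ₀ : 𝓞 K) ∈ v₀.asIdeal →
          ∀ v : HeightOneSpectrum (𝓞 K), (ℓ : 𝓞 K) ∈ v.asIdeal → ∀ (b : Bool)
          (a c : galoisCohomology ((W.baseChange K).torsionGaloisModule ((p ^ 1 : ℕ) : ℤ)) 1),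
          a ∈ signPart W K τ ((p ^ 1 : ℕ) : ℤ) (if b then 1 else -1)
            ((selmerF W ((p ^ 1 : ℕ) : ℤ) 𝒯 (placesDividing K s.1)).relaxedAt {v₀}).selmerGroup →
          c ∈ signPart W K τ ((p ^ 1 : ℕ) : ℤ) (if b then 1 else -1)
            (selmerF W ((p ^ 1 : ℕ) : ℤ) 𝒯 (placesDividing K (s.1 * ℓ₀ * ℓ))).selmerGroup →
          pair v₀ (galoisCohomology.localization ((W.baseChange K).torsionGaloisModule ((p ^ 1 : ℕ) : ℤ))
              (Sum.inr v₀) 1 c)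
            (galoisCohomology.localization ((W.baseChange K).torsionGaloisModule ((p ^ 1 : ℕ) : ℤ))
              (Sum.inr v₀) 1 a) +
          pair v (galoisCohomology.localization ((W.baseChange K).torsionGaloisModule ((p ^ 1 : ℕ) : ℤ))
              (Sum.inr v) 1 c)
            (galoisCohomology.localization ((W.baseChange K).torsionGaloisModule ((p ^ 1 : ℕ) : ℤ))
              (Sum.inr v) 1 a) = 0) ∧
          (∀ (s : {m : ℕ // Squarefree m ∧ ∀ q ∈ m.primeFactors,
            Zhang2014.IsKolyvaginPrime (W.conductorNorm ℤ) W K p q ∧ M + 1 ≤ Zhang2014.kolyvaginIndex W p q})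
            (x : galoisCohomology ((W.baseChange K).torsionGaloisModule ((p ^ 1 : ℕ) : ℤ)) 1),
            torsionH1OfDvd (W.baseChange K) (Int.natCast_dvd_natCast.mpr (pow_dvd_pow p (Nat.le_add_left 1 M))) x =
              (D s).kolyvaginClass (Fact.out : p.Prime) (M + 1) →
            x ∈ signPart W K τ ((p ^ 1 : ℕ) : ℤ) (if eb s.1 then 1 else -1)
              (selmerF W ((p ^ 1 : ℕ) : ℤ) 𝒯 (placesDividing K s.1)).selmerGroup)))
    (hlev : ∀ (W : WeierstrassCurve ℚ) [W.IsElliptic] [W.IsGloballyMinimal] [NeZero (W.conductorNorm ℤ)]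
      (p : ℕ) [Fact p.Prime] (K : Type) [Field K] [NumberField K]
      (Dt : ModularParametrizationData W (W.conductorNorm ℤ)) (β : ℤ) (ι : K →+* ℂ),
      p ∣ W.tamagawaProduct →
      ClassX11b W p → ¬ Surj W p → (p = 5 ∨ p = 7) → p ∣ padicValInt p W.minimalDiscriminantInt →
      ¬ Ram W p → IsImaginaryQuadratic K → 4 < (NumberField.discr K).natAbs →
      SatisfiesHeegnerHypothesis (W.conductorNorm ℤ) K → SatisfiesHeegnerHypothesis p K →
      (4 * (W.conductorNorm ℤ : ℤ)) ∣ β ^ 2 - NumberField.discr K → ¬ (p : ℤ) ∣ Dt.c →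
      ∀ (v : HeightOneSpectrum (𝓞 ℚ)) (k n : ℕ) (d : KolyvaginHeegnerData Dt β ι n), Squarefree n →
        (∀ ℓ ∈ n.primeFactors, Zhang2014.IsKolyvaginPrime (W.conductorNorm ℤ) W K p ℓ) →
        (if divOrd d p < Zhang2014.levelIndex W p n then divOrd d p else (⊤ : ℕ∞)) < (k : ℕ∞) →
        padicValNat p (W.tamagawaNumberAt v) ≤ k →
        (k : ℕ∞) + (if divOrd d p < Zhang2014.levelIndex W p n then divOrd d p else ⊤) ≤
          Zhang2014.levelIndex W p n →
        (padicValNat p (W.tamagawaNumberAt v) : ℕ∞) ≤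
          (if divOrd d p < Zhang2014.levelIndex W p n then divOrd d p else ⊤)) :
    ∀ (W : WeierstrassCurve ℚ) [W.IsElliptic] [W.IsGloballyMinimal] [NeZero (W.conductorNorm ℤ)]
      (p : ℕ) [Fact p.Prime] (K : Type) [Field K] [NumberField K]
      (Dt : ModularParametrizationData W (W.conductorNorm ℤ)) (β : ℤ) (ι : K →+* ℂ),
      p ∣ W.tamagawaProduct →
      ClassX11b W p → ¬ Surj W p → (p = 5 ∨ p = 7) → p ∣ padicValInt p W.minimalDiscriminantInt →
      ¬ Ram W p → IsImaginaryQuadratic K → 4 < (NumberField.discr K).natAbs →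
      SatisfiesHeegnerHypothesis (W.conductorNorm ℤ) K → SatisfiesHeegnerHypothesis p K →
      (4 * (W.conductorNorm ℤ : ℤ)) ∣ β ^ 2 - NumberField.discr K → ¬ (p : ℤ) ∣ Dt.c →
      ∀ (v : HeightOneSpectrum (𝓞 ℚ)) (s : ℕ), s ≤ padicValNat p (W.tamagawaNumberAt v) →
        ∀ (n : ℕ) (d : KolyvaginHeegnerData Dt β ι n), Squarefree n →
          (∀ ℓ ∈ n.primeFactors, Zhang2014.IsKolyvaginPrime (W.conductorNorm ℤ) W K p ℓ ∧
            s ≤ Zhang2014.kolyvaginIndex W p ℓ) → PDiv d p s := by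
  refine nonSurjCornerKolyJ_max_of_levelOneSupply_of_perLevel ?_ hlev
  intro W _ _ _ p _ K _ _ Dt β ι htam hX hns h57 hv hnr hK' hd hHN hHp hβ hc
  obtain ⟨hneg7, hsup⟩ := hsupply W p K Dt β ι htam hX hns h57 hv hnr hK' hd hHN hHp hβ hc
  refine ⟨hneg7, fun M e D hall ↦ ?_⟩
  obtain ⟨τ, hτ, 𝒯, eb, Z, instZ, pair, heb, hPT, hperf, hrec, hκSel⟩ := hsup M e D hall
  have hp3 : p ≠ 3 := by rcases h57 with rfl | rfl <;> decide
  have hDneg : NumberField.discr K < 0 := (isImaginaryQuadratic_iff_discr_neg.1 hK').2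
  have hD : NumberField.discr K < -4 := by omega
  obtain ⟨κb, hι, h44c, hκ0⟩ := exists_levelOne_kappa_of_h44 W hK' hD hHN hX.2.1 hHp hX.2.2.2 Dt β ι M D hall
    (h44_family_of_frobeniusCongruence W h37 hK' hD hHN hX.2.1 hp3 hHp hX.2.2.2 Dt β ι M D)
  exact ⟨τ, hτ, 𝒯, eb, Z, instZ, pair, κb, heb, hPT, hperf, hrec, fun s ↦ hκSel s (κb s) (hι s), h44c, hκ0⟩

/-- **DISPLAY v3 @3 — `stub_upper3_jetchevMax` (19111 Upper kit) ⟸ {Gross Prop. 3.7 (2) BY NAME; (iv′) the level-`3`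
PAIRING supply per family + the `ℓ = 2` residue; hlev}.** The (T4″)@3 twin of
`nonSurjCornerKolyJ_max_of_frobeniusCongruence_of_pairingSupply_of_perLevel`: the κ̄-dictionary of
`cornerUpper3_jetchevMax_of_levelOneSupply_of_perLevel`'s supply (iv) DISCHARGED (avatars constructed; `hκ0` proved;
`h44c` = this seat's kernel Prop. 4.4 on the irreducible corner BY NAME of `GrossLMS1991.prop37_2_frobeniusCongruence`),
EXCEPT at the prime step `ℓ = 2` (a possible Zhang–Kolyvagin prime at `p = 3`, `M = 0`, outside Nekovář's and Gross's
print), which (iv′) carries as an explicit clause on the genuine classes `c_{M+1}(D s)`. `−1 ∈ ρ̄_{E,3}(Γ_ℚ)` is automatic.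
CONDITIONAL; nothing booked; no stub closes. [cite: McCallumLMS1991, §4 Prop. 4.4, §5 Prop. 5.2 (p. 304)]
[cite: GrossLMS1991, Prop. 3.7 (2)] [cite: Nekovar2007, Prop. 4.13 (ii), (4.3)] [cite: BurungaleEtAl2026, Prop. 2.2.1 (§2.2)] -/
theorem cornerUpper3_jetchevMax_of_frobeniusCongruence_of_pairingSupply_of_perLevel
    (h37 : GrossLMS1991.prop37_2_frobeniusCongruence)
    (hsupply : ∀ (W : WeierstrassCurve ℚ) [W.IsElliptic] [W.IsGloballyMinimal] [NeZero (W.conductorNorm ℤ)]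
      (K : Type) [Field K] [NumberField K]
      (Dt : ModularParametrizationData W (W.conductorNorm ℤ)) (β : ℤ) (ι : K →+* ℂ),
      ClassX11b W 3 → ¬ Surj W 3 →
      IsImaginaryQuadratic K → SatisfiesHeegnerHypothesis (W.conductorNorm ℤ) K →
      Odd (NumberField.discr K) →
      (4 * (W.conductorNorm ℤ : ℤ)) ∣ β ^ 2 - NumberField.discr K → ¬ (3 : ℤ) ∣ Dt.c →
      ∀ (M e : ℕ) (D : ∀ s : {m : ℕ // Squarefree m ∧ ∀ q ∈ m.primeFactors,
            Zhang2014.IsKolyvaginPrime (W.conductorNorm ℤ) W K 3 q ∧ M + 1 ≤ Zhang2014.kolyvaginIndex W 3 q},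
          KolyvaginHeegnerData Dt β ι s.1), (∀ s, PDiv (D s) 3 M) →
        ∃ (τ : K ≃ₐ[ℚ] K) (_ : τ ≠ 1)
          (𝒯 : SelmerStructure ((W.baseChange K).torsionGaloisModule ((3 ^ 1 : ℕ) : ℤ))) (eb : ℕ → Bool)
          (Z : Type) (_ : AddCommGroup Z)
          (pair : ∀ v : HeightOneSpectrum (𝓞 K),
          galoisCohomology (((W.baseChange K).torsionGaloisModule ((3 ^ 1 : ℕ) : ℤ)).toLocal (Sum.inr v)) 1 →+
          galoisCohomology (((W.baseChange K).torsionGaloisModule ((3 ^ 1 : ℕ) : ℤ)).toLocal (Sum.inr v)) 1 →+ Z),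
          (∀ (m ℓ : ℕ), ℓ.Prime → ¬ ℓ ∣ m → eb (m * ℓ) = !eb m) ∧
          (∀ (s : {m : ℕ // Squarefree m ∧ ∀ q ∈ m.primeFactors,
            Zhang2014.IsKolyvaginPrime (W.conductorNorm ℤ) W K 3 q ∧ M + 1 ≤ Zhang2014.kolyvaginIndex W 3 q})
          (ℓ : ℕ), Zhang2014.IsKolyvaginPrime (W.conductorNorm ℤ) W K 3 ℓ →
          M + 1 ≤ Zhang2014.kolyvaginIndex W 3 ℓ → ¬ ℓ ∣ s.1 →
          ∀ v : HeightOneSpectrum (𝓞 K), (ℓ : 𝓞 K) ∈ v.asIdeal → ∀ b : Bool,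
          Nat.card ((signPart W K τ ((3 ^ 1 : ℕ) : ℤ) (if b then 1 else -1)
              ((selmerF W ((3 ^ 1 : ℕ) : ℤ) 𝒯 (placesDividing K s.1)).relaxedAt {v}).selmerGroup).map
            (galoisCohomology.localization ((W.baseChange K).torsionGaloisModule ((3 ^ 1 : ℕ) : ℤ))
              (Sum.inr v) 1)) = 3 ^ 1) ∧
          (∀ (ℓ : ℕ), Zhang2014.IsKolyvaginPrime (W.conductorNorm ℤ) W K 3 ℓ →
          M + 1 ≤ Zhang2014.kolyvaginIndex W 3 ℓ → ∀ v : HeightOneSpectrum (𝓞 K), (ℓ : 𝓞 K) ∈ v.asIdeal →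
          ∀ (e : ℤ), (e = 1 ∨ e = -1) →
          ∀ (x y : galoisCohomology ((W.baseChange K).torsionGaloisModule ((3 ^ 1 : ℕ) : ℤ)) 1),
          conjAct W τ ((3 ^ 1 : ℕ) : ℤ) x = e • x → conjAct W τ ((3 ^ 1 : ℕ) : ℤ) y = e • y →
          galoisCohomology.localization ((W.baseChange K).torsionGaloisModule ((3 ^ 1 : ℕ) : ℤ)) (Sum.inr v) 1 x ∈
            𝒯 (Sum.inr v) →
          galoisCohomology.localization ((W.baseChange K).torsionGaloisModule ((3 ^ 1 : ℕ) : ℤ)) (Sum.inr v) 1 y ∈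
            (W.baseChange K).kummerSelmerStructure ((3 ^ 1 : ℕ) : ℤ) (Sum.inr v) →
          galoisCohomology.localization ((W.baseChange K).torsionGaloisModule ((3 ^ 1 : ℕ) : ℤ)) (Sum.inr v) 1 x ≠ 0 →
          galoisCohomology.localization ((W.baseChange K).torsionGaloisModule ((3 ^ 1 : ℕ) : ℤ)) (Sum.inr v) 1 y ≠ 0 →
          pair v (galoisCohomology.localization ((W.baseChange K).torsionGaloisModule ((3 ^ 1 : ℕ) : ℤ)) (Sum.inr v) 1 x)
            (galoisCohomology.localization ((W.baseChange K).torsionGaloisModule ((3 ^ 1 : ℕ) : ℤ)) (Sum.inr v) 1 y) ≠ 0) ∧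
          (∀ (s : {m : ℕ // Squarefree m ∧ ∀ q ∈ m.primeFactors,
            Zhang2014.IsKolyvaginPrime (W.conductorNorm ℤ) W K 3 q ∧ M + 1 ≤ Zhang2014.kolyvaginIndex W 3 q})
          (ℓ₀ ℓ : ℕ), Zhang2014.IsKolyvaginPrime (W.conductorNorm ℤ) W K 3 ℓ₀ → M + 1 ≤ Zhang2014.kolyvaginIndex W 3 ℓ₀ →
          Zhang2014.IsKolyvaginPrime (W.conductorNorm ℤ) W K 3 ℓ → M + 1 ≤ Zhang2014.kolyvaginIndex W 3 ℓ →
          ¬ ℓ₀ ∣ s.1 → ¬ ℓ ∣ s.1 → ℓ ≠ ℓ₀ →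
          ∀ v₀ : HeightOneSpectrum (𝓞 K), (ℓ₀ : 𝓞 K) ∈ v₀.asIdeal →
          ∀ v : HeightOneSpectrum (𝓞 K), (ℓ : 𝓞 K) ∈ v.asIdeal → ∀ (b : Bool)
          (a c : galoisCohomology ((W.baseChange K).torsionGaloisModule ((3 ^ 1 : ℕ) : ℤ)) 1),
          a ∈ signPart W K τ ((3 ^ 1 : ℕ) : ℤ) (if b then 1 else -1)
            ((selmerF W ((3 ^ 1 : ℕ) : ℤ) 𝒯 (placesDividing K s.1)).relaxedAt {v₀}).selmerGroup →
          c ∈ signPart W K τ ((3 ^ 1 : ℕ) : ℤ) (if b then 1 else -1)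
            (selmerF W ((3 ^ 1 : ℕ) : ℤ) 𝒯 (placesDividing K (s.1 * ℓ₀ * ℓ))).selmerGroup →
          pair v₀ (galoisCohomology.localization ((W.baseChange K).torsionGaloisModule ((3 ^ 1 : ℕ) : ℤ))
              (Sum.inr v₀) 1 c)
            (galoisCohomology.localization ((W.baseChange K).torsionGaloisModule ((3 ^ 1 : ℕ) : ℤ))
              (Sum.inr v₀) 1 a) +
          pair v (galoisCohomology.localization ((W.baseChange K).torsionGaloisModule ((3 ^ 1 : ℕ) : ℤ))
              (Sum.inr v) 1 c)
            (galoisCohomology.localization ((W.baseChange K).torsionGaloisModule ((3 ^ 1 : ℕ) : ℤ))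
              (Sum.inr v) 1 a) = 0) ∧
          (∀ (s : {m : ℕ // Squarefree m ∧ ∀ q ∈ m.primeFactors,
            Zhang2014.IsKolyvaginPrime (W.conductorNorm ℤ) W K 3 q ∧ M + 1 ≤ Zhang2014.kolyvaginIndex W 3 q})
            (x : galoisCohomology ((W.baseChange K).torsionGaloisModule ((3 ^ 1 : ℕ) : ℤ)) 1),
            torsionH1OfDvd (W.baseChange K) (Int.natCast_dvd_natCast.mpr (pow_dvd_pow 3 (Nat.le_add_left 1 M))) x =
              (D s).kolyvaginClass Nat.prime_three (M + 1) →
            x ∈ signPart W K τ ((3 ^ 1 : ℕ) : ℤ) (if eb s.1 then 1 else -1)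
              (selmerF W ((3 ^ 1 : ℕ) : ℤ) 𝒯 (placesDividing K s.1)).selmerGroup) ∧
          (∀ (s s' : {m : ℕ // Squarefree m ∧ ∀ q ∈ m.primeFactors,
            Zhang2014.IsKolyvaginPrime (W.conductorNorm ℤ) W K 3 q ∧ M + 1 ≤ Zhang2014.kolyvaginIndex W 3 q}),
          Zhang2014.IsKolyvaginPrime (W.conductorNorm ℤ) W K 3 2 → M + 1 ≤ Zhang2014.kolyvaginIndex W 3 2 →
          ¬ 2 ∣ s.1 → s'.1 = s.1 * 2 → ∀ v : HeightOneSpectrum (𝓞 K), (2 : 𝓞 K) ∈ v.asIdeal →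
          ((D s').kolyvaginClass Nat.prime_three (M + 1) ∈
              (W.baseChange K).torsionLocalKer (v.adicCompletion K) ((3 ^ (M + 1) : ℕ) : ℤ) ↔
            (D s).kolyvaginClass Nat.prime_three (M + 1) ∈
              (W.baseChange K).torsionLocalKer (v.adicCompletion K) ((3 ^ (M + 1) : ℕ) : ℤ))))
    (hlev : ∀ (W : WeierstrassCurve ℚ) [W.IsElliptic] [W.IsGloballyMinimal] [NeZero (W.conductorNorm ℤ)]
      (K : Type) [Field K] [NumberField K]
      (Dt : ModularParametrizationData W (W.conductorNorm ℤ)) (β : ℤ) (ι : K →+* ℂ),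
      ClassX11b W 3 → ¬ Surj W 3 →
      IsImaginaryQuadratic K → SatisfiesHeegnerHypothesis (W.conductorNorm ℤ) K →
      Odd (NumberField.discr K) →
      (4 * (W.conductorNorm ℤ : ℤ)) ∣ β ^ 2 - NumberField.discr K → ¬ (3 : ℤ) ∣ Dt.c →
      ∀ (v : HeightOneSpectrum (𝓞 ℚ)) (k n : ℕ) (d : KolyvaginHeegnerData Dt β ι n), Squarefree n →
        (∀ ℓ ∈ n.primeFactors, Zhang2014.IsKolyvaginPrime (W.conductorNorm ℤ) W K 3 ℓ) →
        (if divOrd d 3 < Zhang2014.levelIndex W 3 n then divOrd d 3 else (⊤ : ℕ∞)) < (k : ℕ∞) →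
        padicValNat 3 (W.tamagawaNumberAt v) ≤ k →
        (k : ℕ∞) + (if divOrd d 3 < Zhang2014.levelIndex W 3 n then divOrd d 3 else ⊤) ≤
          Zhang2014.levelIndex W 3 n →
        (padicValNat 3 (W.tamagawaNumberAt v) : ℕ∞) ≤
          (if divOrd d 3 < Zhang2014.levelIndex W 3 n then divOrd d 3 else ⊤)) :
    ∀ (W : WeierstrassCurve ℚ) [W.IsElliptic] [W.IsGloballyMinimal] [NeZero (W.conductorNorm ℤ)]
      (K : Type) [Field K] [NumberField K]
      (Dt : ModularParametrizationData W (W.conductorNorm ℤ)) (β : ℤ) (ι : K →+* ℂ),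
      ClassX11b W 3 → ¬ Surj W 3 →
      IsImaginaryQuadratic K → SatisfiesHeegnerHypothesis (W.conductorNorm ℤ) K →
      Odd (NumberField.discr K) →
      (4 * (W.conductorNorm ℤ : ℤ)) ∣ β ^ 2 - NumberField.discr K → ¬ (3 : ℤ) ∣ Dt.c →
      ∀ (v : HeightOneSpectrum (𝓞 ℚ)) (s : ℕ), s ≤ padicValNat 3 (W.tamagawaNumberAt v) →
        ∀ (n : ℕ) (d : KolyvaginHeegnerData Dt β ι n), Squarefree n →
          (∀ ℓ ∈ n.primeFactors, Zhang2014.IsKolyvaginPrime (W.conductorNorm ℤ) W K 3 ℓ ∧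
            s ≤ Zhang2014.kolyvaginIndex W 3 ℓ) → PDiv d 3 s := by
  haveI : Fact (Nat.Prime 3) := ⟨Nat.prime_three⟩
  refine cornerUpper3_jetchevMax_of_levelOneSupply_of_perLevel ?_ hlev
  intro W _ _ _ K _ _ Dt β ι hX hns hK' hHN hodd hβ hc M e D hall
  obtain ⟨τ, hτ, 𝒯, eb, Z, instZ, pair, heb, hPT, hperf, hrec, hκSel, h2⟩ :=
    hsupply W K Dt β ι hX hns hK' hHN hodd hβ hc M e D hall
  have h3N : 3 ∣ W.conductorNorm ℤ := dvd_conductorNorm_of_mult hX.2.2.1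
  have hH3 : SatisfiesHeegnerHypothesis 3 K := hHN.of_dvd h3N
  have h3d : ¬ (3 : ℤ) ∣ NumberField.discr K := by
    exact_mod_cast Literature.SatisfiesHeegnerHypothesis.not_dvd_discr hK'.1 hHN Nat.prime_three h3N
  have hd : 4 < (NumberField.discr K).natAbs := four_lt_natAbs_discr_of_odd hK'.1 hodd h3d
  have hDneg : NumberField.discr K < 0 := (isImaginaryQuadratic_iff_discr_neg.1 hK').2
  have hD : NumberField.discr K < -4 := by omega
  obtain ⟨κb, hι, h44c, hκ0⟩ := exists_levelOne_kappa_of_h44 W hK' hD hHN (by decide) hH3 hX.2.2.2 Dt β ι M D hall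
    (h44_family_three_of_frobeniusCongruence W h37 hK' hD hHN hH3 hX.2.2.2 Dt β ι M D h2)
  exact ⟨τ, hτ, 𝒯, eb, Z, instZ, pair, κb, heb, hPT, hperf, hrec, fun s ↦ hκSel s (κb s) (hι s), h44c, hκ0⟩

end Summit.BirchSwinnertonDyer.Rank1Residual.X11b.Three.Koly

end
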